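import Summits.QuantumFields.BalabanUV.Beta.FP.BlockAveragedPropagator
import Summits.QuantumFields.BalabanUV.Beta.FP.BlockAveragedRemainderWindowAxial

/-!
# Road FP (binder row D1), row H′2-IR ∕ IR-1 — `R^Q_{BF}` AT `P^{BF} := Re PinfKer`, MODULO IR-2: SOURCE-VARIABLE DIFFERENCES `≤ C·n⁻³` AND THE
# WINDOW FORM (T2-win) `Σ_{q∈box 4 n}|Δ_νΔ_μ R^Q_{BF}| ≤ C` LOG-FREE — the instances of `BlockAveragedRemainderSource` ∕ `BlockAveragedRemainderWindow`
# at the KER-ASM letters (P0)∕(P1) of `FP/BlockAveragedPropagator` (our bookkeeping)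

HONEST DEPENDENCY (page 1, mandatory): continuum YM on T⁴ ⇐ BetaPertH ∧ nine spine estimates (0/9 proved); BetaPertH ⇐ (D1) ∧ (D4) ∧
CAP+tail; G-an2-4 gates asym, D1 and NE2/3/4.  HONEST FRAMING (cell contract, verbatim): «discharging `BetaPertH` makes Bałaban's UV
stability UNCONDITIONAL — a real constructive-QFT result; it is NOT the continuum limit and NOT the Clay problem.»  THIS MODULE is
instantiation bookkeeping over this lineage's IR-1 `FP/BlockAveragedPropagator` ((P0) `abs_Pbf_le`, (P1) `abs_Pbf_fwdDiff_le`, themselves from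
gan24-formalise-leaf-05-g35's KER-ASM v1 (K0)(K1) + an3's free-leg letters) and IR-Q supplements `FP/BlockAveragedRemainderSource` ∕ `…WindowAxial`, BY NAME;
it cites nothing, declares no `def`, mints no `def … : Prop`, has 0 `sorry`.  The coarse inverse `G` is HYPOTHETICAL with IR-2's displayed letters
((G-exp) `|G α β u v| ≤ K·n²·e^{−δ‖u−v‖∞}`, (G-inv) against the mass-one `C_n^{BF}`); nothing here estimates `G_C`.  It discharges NOTHING of
row H′2-IR ∕ `ρ_a` ∕ `hasym` ∕ D1 ∕ `BetaPertH` by itself; NEVER «G-an2-4 closed»; NOT (CONV-C), NOT D1, NOT the continuum limit, NOT Clay.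

ABSOLUTE RULE (cell charter, verbatim): «No internally-minted statement may enter as a cited fact. Every hypothesis is either
kernel-proved in this package or a verbatim quotation of a PUBLISHED theorem with page reference. The manuscript(s) under audit are NOT
citable for their own disputed steps — they are the thing under adjudication; programme-internal (2001/route/tribunal) claims are never
citable.»

CONTENT. §1 `abs_remQ_bf_sub_right_le` — `|R^Q_{BF}((x,μ),(y+e_i,ν)) − R^Q_{BF}((x,μ),(y,ν))| ≤ C(K,δ)∕n³`, n-free `C`; §2 `sum_box_abs_remQ_bf_fwdDiff₂_le` —
the radius-`n` window sum of target-variable second differences `≤ C(K,δ)`, log-free (R-FP-20).  With `FP/BlockAveragedPropagator` ((T0), (T1) target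
variable) these are the near-region letters of `R^Q_{BF}` in E-FP-5-2's powers, GLOBAL, modulo IR-2 (iv)(v) only.
Unit `b2b-balaban-gan24-formalise-leaf-04` (gen 40; cross-lane idle G-an2-4 swarm leaf seat on road FP), 2026-08-20; rows IR-1 (l.212) ∕ IR-Q (l.236) of `LEAVES-FP.md`.
-/

namespace Summit.QuantumFields.BalabanUV.Beta.FP.BlockAveragedPropagatorWindow

open Finset
open scoped BigOperators
open Literature.Probability.LatticeModels (box)
open Literature.MathematicalPhysics.QuantumFieldTheory.Balaban1983to89.Beta
open Literature.MathematicalPhysics.QuantumFieldTheory.Balaban1983to89.Beta.DyadicShell (Pt supNorm)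
open Literature.MathematicalPhysics.QuantumFieldTheory.Balaban1983to89.Beta.BubbleTransfer (c4)
open Literature.MathematicalPhysics.QuantumFieldTheory.Balaban1983to89.Beta.TwoPowerLegs (free)
open Literature.MathematicalPhysics.QuantumFieldTheory.Balaban1983to89.Beta.AxialComposition (axialAvg)
open Summit.QuantumFields.BalabanUV.Beta.FP.PerfectPropagatorKernel (PinfKer CKB CB0)
open Summit.QuantumFields.BalabanUV.Beta.FP.LatticeConvolutionBounds (exp_neg_supNorm_le_div_pow)
open Summit.QuantumFields.BalabanUV.Beta.FP.BlockAveragedPropagator (abs_Pbf_le abs_Pbf_fwdDiff_le)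
open Summit.QuantumFields.BalabanUV.Beta.FP.BlockAveragedRemainderSource (abs_remQ_sub_right_le)
open Summit.QuantumFields.BalabanUV.Beta.FP.BlockAveragedRemainderWindowAxial (sum_box_abs_remQ_fwdDiff₂_le)

noncomputable section

/-! ## §1 Source-variable differences at `P^{BF}` -/

/-- **SOURCE-VARIABLE DIFFERENCES OF `R^Q_{BF}` ARE `O(n⁻³)`, MODULO IR-2** [our bookkeeping]: with the exponential coarse letter
`|G α β u v| ≤ K·n²·e^{−δ‖u−v‖∞}` and (G-inv) against the mass-one `C_n^{BF}`, for all fine bonds and every direction `i`,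
`|R^Q_{BF}((x,μ),(y+e_i,ν)) − R^Q_{BF}((x,μ),(y,ν))| ≤ (4·162·36·531442·C₀^{BF}·4·1296·(K·e^δ·5!∕δ⁵)·216·531442·C₁^{BF}) ∕ n³` — n-FREE constant over `n³`. -/
theorem abs_remQ_bf_sub_right_le {n : ℕ} (hn : 1 ≤ n) {G : Fin 4 → Fin 4 → Pt → Pt → ℝ} {K δ : ℝ} (hδ : 0 < δ) (hK : 0 ≤ K)
    (hGexp : ∀ α β u v, |G α β u v| ≤ K * (n : ℝ) ^ 2 * Real.exp (-(δ * supNorm (u - v))))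
    (hinv : ∀ (w : Pt) (ν α : Fin 4) (u : Pt), HasSum
      (fun v => ∑ β, G α β u v * axialAvg n ν (fun y' => axialAvg n β (fun t => (PinfKer (d := 3) ν β (y' - t)).re) v) w)
      (if u = w ∧ α = ν then 1 else 0))
    (μ ν : Fin 4) (x y : Pt) (i : Fin 4) :
    |(∑' u, ∑ α, axialAvg n α (fun v => (PinfKer (d := 3) μ α (x - v)).re) u
          * ∑' v, ∑ β, G α β u v * axialAvg n β (fun t => (PinfKer (d := 3) ν β (y + Pi.single i 1 - t)).re) v)
      - (∑' u, ∑ α, axialAvg n α (fun v => (PinfKer (d := 3) μ α (x - v)).re) u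
          * ∑' v, ∑ β, G α β u v * axialAvg n β (fun t => (PinfKer (d := 3) ν β (y - t)).re) v)|
        ≤ (4 * 162 * (36 * 531442 * (4 * (free.U + c4 + free.B) + (4 * CKB 3 + CB0 3)))
            * (4 * 1296 * (K * (Real.exp δ * (Nat.factorial 5) / δ ^ 5))
              * (216 * 531442 * (8 * (2 * free.U + 2 * c4 + free.Bgrad) + (31 * CKB 3 + 16 * CB0 3))))) / (n : ℝ) ^ 3 := by
  have hn0 : (0 : ℝ) < n := by exact_mod_cast hn
  have hKn : 0 ≤ K * (n : ℝ) ^ 2 := by positivity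
  have hGp : ∀ α β u v, |G α β u v|
      ≤ (K * (n : ℝ) ^ 2 * (Real.exp δ * (Nat.factorial 5) / δ ^ 5)) / ((supNorm (u - v) : ℝ) + 1) ^ 5 :=
    fun α β u v => (hGexp α β u v).trans (exp_neg_supNorm_le_div_pow hδ hKn 5 (u - v))
  have h := abs_remQ_sub_right_le (P := fun μ α z => (PinfKer (d := 3) μ α z).re) (fun μ α z => abs_Pbf_le μ α z)
    (fun μ α i z => abs_Pbf_fwdDiff_le μ α i z) hn hGp hinv μ ν x y i
  refine h.trans (le_of_eq ?_)
  simp only [Fintype.card_fin]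
  push_cast
  field_simp

/-! ## §2 The window form at `P^{BF}` -/

/-- **(T2-win) FOR `R^Q_{BF}`, MODULO IR-2** [our bookkeeping]: with the exponential coarse letter `|G α β u v| ≤ K·n²·e^{−δ‖u−v‖∞}` and (G-inv) against
the mass-one `C_n^{BF}`, the radius-`n` window sum of the second differences (target variable) of `R^Q_{BF}` is bounded by an n-FREE constant:
`Σ_{q∈box 4 n} |Δ_νΔ_μ R^Q_{BF}((n•w+q, μ′),(y,ν′))| ≤ 4·162·(9·82944·C₁^{BF})·(4·1296·(K·e^δ·5!∕δ⁵)·13824·531442·C₁^{BF} + 1)` — log-free. -/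
theorem sum_box_abs_remQ_bf_fwdDiff₂_le {n : ℕ} (hn : 1 ≤ n) {G : Fin 4 → Fin 4 → Pt → Pt → ℝ} {K δ : ℝ} (hδ : 0 < δ) (hK : 0 ≤ K)
    (hGexp : ∀ α β u v, |G α β u v| ≤ K * (n : ℝ) ^ 2 * Real.exp (-(δ * supNorm (u - v))))
    (hinv : ∀ (w : Pt) (ν α : Fin 4) (u : Pt), HasSum
      (fun v => ∑ β, G α β u v * axialAvg n ν (fun y' => axialAvg n β (fun t => (PinfKer (d := 3) ν β (y' - t)).re) v) w)
      (if u = w ∧ α = ν then 1 else 0))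
    (μ' ν' μ ν : Fin 4) (w y : Pt) :
    ∑ q ∈ box 4 n,
      |(∑' u, ∑ α, axialAvg n α (fun v => (PinfKer (d := 3) μ' α (n • w + q + Pi.single ν 1 + Pi.single μ 1 - v)).re) u
            * ∑' v, ∑ β, G α β u v * axialAvg n β (fun t => (PinfKer (d := 3) ν' β (y - t)).re) v)
        - (∑' u, ∑ α, axialAvg n α (fun v => (PinfKer (d := 3) μ' α (n • w + q + Pi.single ν 1 - v)).re) u
            * ∑' v, ∑ β, G α β u v * axialAvg n β (fun t => (PinfKer (d := 3) ν' β (y - t)).re) v)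
        - (∑' u, ∑ α, axialAvg n α (fun v => (PinfKer (d := 3) μ' α (n • w + q + Pi.single μ 1 - v)).re) u
            * ∑' v, ∑ β, G α β u v * axialAvg n β (fun t => (PinfKer (d := 3) ν' β (y - t)).re) v)
        + (∑' u, ∑ α, axialAvg n α (fun v => (PinfKer (d := 3) μ' α (n • w + q - v)).re) u
            * ∑' v, ∑ β, G α β u v * axialAvg n β (fun t => (PinfKer (d := 3) ν' β (y - t)).re) v)|
      ≤ 4 * 162 * (9 * 82944 * (8 * (2 * free.U + 2 * c4 + free.Bgrad) + (31 * CKB 3 + 16 * CB0 3)))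
          * (4 * 1296 * (K * (Real.exp δ * (Nat.factorial 5) / δ ^ 5))
              * (13824 * 531442 * (8 * (2 * free.U + 2 * c4 + free.Bgrad) + (31 * CKB 3 + 16 * CB0 3))) + 1) := by
  have hn0 : (0 : ℝ) < n := by exact_mod_cast hn
  have hKn : 0 ≤ K * (n : ℝ) ^ 2 := by positivity
  have hGp : ∀ α β u v, |G α β u v|
      ≤ (K * (n : ℝ) ^ 2 * (Real.exp δ * (Nat.factorial 5) / δ ^ 5)) / ((supNorm (u - v) : ℝ) + 1) ^ 5 :=
    fun α β u v => (hGexp α β u v).trans (exp_neg_supNorm_le_div_pow hδ hKn 5 (u - v))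
  have h := sum_box_abs_remQ_fwdDiff₂_le (P := fun μ α z => (PinfKer (d := 3) μ α z).re) (fun μ α z => abs_Pbf_le μ α z)
    (fun μ α i z => abs_Pbf_fwdDiff_le μ α i z) hn hGp hinv μ' ν' μ ν w y
  refine h.trans (le_of_eq ?_)
  simp only [Fintype.card_fin]
  push_cast
  field_simp

end

end Summit.QuantumFields.BalabanUV.Beta.FP.BlockAveragedPropagatorWindow
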